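import Mathlib
import Summits.ResolutionOfSingularities.ResolutionOfSingularities.Theorems.PerronSigmaAscent
import HarnessLib


/-!
# WCut — TREE-FACING COMPANION of the gen-20 node `PerturbationLadder`, PART IX (§31–§32)

WRITER PROVENANCE (decomp-res-writer-1 g8, 2026-08-30T23:40:59Z): landed VERBATIM from
`HOME/decomp-res-lens-1/g20/tree/WCut.lean` (sha256 2523ba89…; node `g20/PerturbationLadder.lean` c0f73e29 PART IX
§31–§32, WRITER.md d15638b0) under CRITIC-LEDGER row 153 (CLEARED, lens-1 g20 MAP +2 — item (2): the W-cut of the true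
residual `NonKHToricArchLU 3 3 4`, exact iff `nonKHToricArchLU_iff_wcut`, kernel vanishing law, inhabitants I3 /
I3_ℓ); writer changes = file-level linter option dropped, four docstrings added to undocumented theorems, two
docstring lines re-wrapped. Valuative side (supports stmt-ResolutionOfSingularities-0641, helper); the closure to
register is `closes_wcut` (supersedes `PerronSigmaAscent.closes_sigma` as the lens-1 spine closure: the residual
binder replaced by the two W-halves).

The graded-derivation invariant `W(K,v)` (`IsContractive`, `WNonzero`), its vanishing law on places with
`p`-divisible values and `k`-rational residues (`not_wNonzero_of_frobeniusDivisible`), and the exact cut of the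
true residual `NonKHToricArchLU e c n ↔ NonKHToricArchLUWZero e c n ∧ NonKHToricArchLUWPos e c n` with the
re-threaded root closure `closes_wcut` / `root_iff_wcut_sigma`.  This file is the node's `section WCut` VERBATIM,
re-pointed (by `open`) at the landed tree declarations `KaplanskyLadder.NonKHToricArchLU`,
`KaplanskyLadder.nonKHToricArchLU_of_root`, `DefectlessLadder.closes_sigma`,
  `DefectlessLadder.root_iff_nonKHToric_sigma`,
`PerronLadder.KK05NCVAscent`; pure additions.  Suggested landing: `Theorems/WCut.lean` (writer-1), namespace below.
(Unrelated homonym: `Literature.Analysis.Convex.PhiContractions.IsContractive` — metric contractions; different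
namespace, never opened here.)
-/

namespace Summit.ResolutionOfSingularities.ResolutionOfSingularities.Theorems.WCut

open IsLocalRing Literature.AlgebraicGeometry.Resolution
open Summit.ResolutionOfSingularities.ResolutionOfSingularities.Theses
open Summit.ResolutionOfSingularities.ResolutionOfSingularities.Theorems
open Summit.ResolutionOfSingularities.ResolutionOfSingularities.Theorems.PfaffLine
open Summit.ResolutionOfSingularities.ResolutionOfSingularities.Theorems.ToricLadder
open Summit.ResolutionOfSingularities.ResolutionOfSingularities.Theorems.KaplanskyLadder
open Summit.ResolutionOfSingularities.ResolutionOfSingularities.Theorems.PerronLadder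
open Summit.ResolutionOfSingularities.ResolutionOfSingularities.Theorems.DefectlessLadder

/-! # PART IX — THE W-CUT OF THE TRUE RESIDUAL (gen 20, row 131 (iii))

## 31. The graded-derivation invariant `W(K,v)` and its vanishing law

SETTING (hypothesis-free). `k ⊆ K` fields, `O` a valuation subring of `K`, `v := O.valuation`.  A `k`-derivation
`D : K → K` (Mathlib `Derivation k K K`) is CONTRACTIVE (`IsContractive O D`) when `v(D f) ≤ v f` for every `f`.
For such `D` and `f ≠ 0` the quotient `D f / f` lies in `O`; when the residues of `O` are `k`-rational its residue
`χ_D(f) ∈ k` depends only on `v f` [`f' = c(1+m)f`, `c ∈ kˣ`, `v m < 1` ⇒ `D f'/f' = D f/f + D m/(1+m)`,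
`v(D m) ≤ v m < 1`] and is additive: `χ_D ∈ Hom(Γ_K, k)`, and `W(K,v) := {χ_D : D contractive}` is the invariant
of the gen-17 certificates (g17 NODE §3, Lemma C).  We type exactly what the cut needs:
`WNonzero k O :⇔ ∃ D contractive, ∃ f ≠ 0, v(D f) = v f` (⇔ some `χ_D ≠ 0`).

KERNEL LAW (`valuation_derivation_lt_of_frobeniusDivisible`, `not_wNonzero_of_frobeniusDivisible`).  If `K` has
characteristic `p`, every value is the value of a `p`-th power (`∀ f ≠ 0, ∃ g, v f = v(g^p)`: `Γ_K` is
`p`-divisible) and the residues of `O` are `k`-rational, then every contractive `k`-derivation is STRICTLY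
contracting: `W(K,v) = 0`.  Proof (kernel): `f = u·g^p` with `v u = 1`, `u = c + m`, `c ∈ k`, `v m < 1`;
`D(g^p) = p·g^{p-1}·D g = 0` and `D c = 0`, so `D f = g^p · D m` and `v(D f) ≤ v(g^p)·v m < v f`.  (No primality is
used; for `p = 0` the divisibility hypothesis degenerates to `v ≡ 1` on `Kˣ` and the conclusion still holds.)

## 32. The cut and its two certified inhabitants

THE CUT (kernel, `nonKHToricArchLU_iff_wcut`): `NonKHToricArchLU e c n ↔ NonKHToricArchLUWZero e c n ∧
NonKHToricArchLUWPos e c n`, the true residual split along `¬ WNonzero k O` / `WNonzero k O` (excluded middle —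
an exact iff, both halves WEAKER than the root: `…_of_root`).  `closes_wcut` is `closes_sigma` with the residual
piece replaced by the two halves (every `d ≥ 4`); the located pair is `(NonKHToricArchLUWZero 3 3 4,
NonKHToricArchLUWPos 3 3 4)`, tags UNDECIDED · UNDECIDED.

CERTIFIED INHABITANTS ON BOTH SIDES (both inside the hypotheses of `NonKHToricArchLU 3 3 4`; `k` any field of
characteristic `p > 0`).
* `W = 0` half ∋ I3 (g16 §3 / g17 §3: `K = k(x₁,…,x₄)`, `Γ_K = ℤ[1/p]·(ℤ ⊕ ℤ√2 ⊕ ℤ√3)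
⊂ ℝ`, residue field `k`):
  `Γ_K` is `p`-divisible and residues are `k`-rational, so `¬ WNonzero k O` by the KERNEL LAW and nothing else.
* `W ≠ 0` half ∋ I3_ℓ (NEW; `ℓ` any prime `≠ p`; paper, elementary).  In the Hahn field `𝕃 := kᵃ((t^ℝ))`
  (well-ordered supports, `t`-adic valuation; maximally complete, hence henselian) put `x₁ := t`, `x₂ := t^{√2}`,
  `x₃ := t^{√3}` — so `F₀ := k(x₁,x₂,x₃)` carries the monomial valuation, `Γ_{F₀} = Γ₀ := ℤ ⊕ ℤ√2 ⊕ ℤ√3`, residue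
  field `k` — and `x₄ := Σ_{j≥1} t^{e_j}`, `e_j := N_j + d_j/ℓ^j`, where `d_j` runs cyclically through `1, √2, √3`
  and the positive integers `N_j` satisfy `N_{j+1} ≥ N_j + 1` and `N_j ≡ -(ℓ^j)⁻¹ (mod p)` (so `0 < e₁ < e₂ < …`:
  a legitimate series).  `K := F₀(x₄) ⊂ 𝕃` with the induced valuation, `O := 𝒪_𝕃 ∩ K`, `G := ℤ[1/ℓ]·Γ₀`.
  (a) `Γ_K = G`, residue field `k`, rank one, `trdeg_k K = 4`.  `⊆`: every generator has support in the group
  `G`, so `K ⊆ k((t^G))`, whose value group is `G` and residue field `k`.  `⊇`, by Krasner's lemma exactly as in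
  [Kuhlmann 2004 = arXiv:1003.5685 (Trans. AMS 356), Prop. 3.16 with Lemma 3.13]: `η_j := t^{e_j}` is a root of
  `Y^{ℓ^j} - μ_j`, `μ_j ∈ F₀` a monomial, hence separable-algebraic over `F₀` (`ℓ ≠ p`) with
conjugates `ζ·η_j`,
  `ζ^{ℓ^j} = 1`, so its Krasner constant over any intermediate field is `≤ e_j`; if `η₁,…,η_{j-1} ∈ K^h`
  (henselization inside `𝕃`), then `b := x₄ - η₁ - … - η_{j-1} ∈ K^h` and `v(b - η_j) = e_{j+1} > e_j` give
  `η_j ∈ K^h`.  Hence `e_j ∈ vK^h = vK` for all `j`, i.e. `d_j/ℓ^j ∈ Γ_K`; each direction recurs with arbitrarily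
  large `j`, so `Γ_K ⊇ G`.  `[G : Γ₀] = ∞` forces `x₄` transcendental over `F₀`.
  (b) Residual membership, by value groups alone, verbatim as for I3 (g16 §3, g17 §3) with `ℓ` in place of `p`:
  `G` is `ℓ`-divisible, so `Hom(G, ℤ) = 0` and a toric–dense presentation `(F₁, ρ, x)` (density gives
  `Γ_K = Γ_{F₁} ⊕ ℤ^ρ`) has `ρ = 0`; then — and likewise for a dense datum of base `< 4`, and for a
Kaplansky–Hensel
  datum, where `K ⊆ F₁(z)^h` with `F₁(z)|F₁` immediate — `Γ_K ⊆ Γ_{F₁}` with `F₁` finitely generated of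
  transcendence degree `≤ 3 = rr Γ_K`, so `v|F₁` is Abhyankar and `Γ_{F₁}`, hence `Γ_K`, finitely generated:
  impossible.  `rr Γ_K = 3 < 4` with residue field `k`: non-Abhyankar, zero-dimensional; `Γ_K ⊂ ℝ`: rank one;
  `char k = p`.
  (c) `WNonzero k O`.  Let `χ : G → 𝔽_p ⊆ k`, `Σ qᵢbᵢ ↦ (q₁ + q₂ + q₃) mod p` (`b = (1, √2,
√3)`, `qᵢ ∈ ℤ[1/ℓ]`,
  reduction mod `p` being defined because `ℓ` is invertible mod `p`).  The TWISTED EULER DERIVATION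
  `∂_χ(Σ a_γ t^γ) := Σ χ(γ) a_γ t^γ` of `k((t^G))` is a `k`-derivation (Leibniz: `χ(α+β) = χ(α)+χ(β)`) preserving
  supports, hence contractive, with `∂_χ xᵢ = xᵢ` for `i ≤ 3` (`χ(bᵢ) = 1`) and
  `∂_χ x₄ = Σ_j χ(e_j) t^{e_j} = 0` since `χ(e_j) = N_j + (ℓ^j)⁻¹ ≡ 0 (mod p)`.  So `∂_χ` maps the
generators of
  `K` into `K` and restricts to the `k`-derivation `D = x₁∂₁ + x₂∂₂ + x₃∂₃` of `K =
k(x₁,…,x₄)` (the Euler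
  derivation in the first three variables), which is therefore CONTRACTIVE for `O` with `v(D x₁) = v(x₁)`,
  `x₁ ≠ 0`: `WNonzero k O`.  (For I3 this recipe is excluded by the KERNEL LAW: there `η_j = t^{N_j + d_j/p^j}` is
  purely inseparable over `F₀` and every additive character of the `p`-divisible `Γ_K` into `k` vanishes.)
WHAT THE CUT EXPOSES (NODE-g20.md §4): the true residual is not only «defect» — I3_ℓ is a residual place whose top
`x₄` over the monomial base is NOT immediate (infinite TAME ramification, `[Γ_K : Γ₀]` an infinite `ℓ`-group),
invisible to the KH / dense / toric cells; `W` separates it from the wild I3.  Neither half is claimed DECIDED.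
-/

section WCut

variable {k K : Type} [Field k] [Field K] [Algebra k K]

/-- HELPER DEFINITION (gen 20, §31). A `k`-derivation `D` of `K` is CONTRACTIVE for the place `O` when it does
not lower values: `v (D f) ≤ v f` for every `f`. -/
def IsContractive (O : ValuationSubring K) (D : Derivation k K K) : Prop :=
  ∀ f : K, O.valuation (D f) ≤ O.valuation f

variable (k) in
/-- HELPER DEFINITION (gen 20, §31; the invariant `W(K,v)` of g17 NODE §3). `W(K,v) ≠ 0`: some contractive
`k`-derivation of `K` attains `v (D f) = v f` at some `f ≠ 0`, i.e. its graded character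
`χ_D (v f) := residue (D f / f)` is not identically zero. -/
def WNonzero (O : ValuationSubring K) : Prop :=
  ∃ D : Derivation k K K, IsContractive O D ∧ ∃ f : K, f ≠ 0 ∧ O.valuation (D f) = O.valuation f

/-- KERNEL LAW (gen 20, §31): on a place of characteristic `p` whose values are all values of `p`-th powers
(`p`-divisible value group) and whose residues are `k`-rational, every contractive `k`-derivation is STRICTLY
contracting. [folklore] -/
theorem valuation_derivation_lt_of_frobeniusDivisible (O : ValuationSubring K) (p : ℕ) [CharP K p]
    (hres : ∀ z ∈ O, ∃ c : k, O.valuation (z - algebraMap k K c) < 1)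
    (hdiv : ∀ f : K, f ≠ 0 → ∃ g : K, O.valuation f = O.valuation (g ^ p))
    (D : Derivation k K K) (hD : IsContractive O D) {f : K} (hf : f ≠ 0) :
    O.valuation (D f) < O.valuation f := by
  obtain ⟨g, hg⟩ := hdiv f hf
  set q : K := g ^ p with hq_def
  have hvf : O.valuation f ≠ 0 := (Valuation.ne_zero_iff _).2 hf
  have hq : q ≠ 0 := by
    intro h0
    rw [h0, Valuation.map_zero] at hg
    exact hvf hg
  have hvq : O.valuation q ≠ 0 := (Valuation.ne_zero_iff _).2 hq
  set u : K := f / q with hu_def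
  have hfu : f = u * q := by rw [hu_def, div_mul_cancel₀ f hq]
  have hvu : O.valuation u = 1 := by
    rw [hu_def, map_div₀, hg, div_self hvq]
  have hu_mem : u ∈ O := (O.valuation_le_one_iff u).1 hvu.le
  obtain ⟨c, hc⟩ := hres u hu_mem
  set m : K := u - algebraMap k K c with hm_def
  -- `D` kills `q = g ^ p` (characteristic `p`) and the constant `c`.
  have hDq : D q = 0 := by
    rw [hq_def, D.leibniz_pow, ← Nat.cast_smul_eq_nsmul K, CharP.cast_eq_zero K p, zero_smul]
  have hDf : D f = q * D m := by
    have h1 : D f = q * D u := by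
      rw [hfu, D.leibniz, hDq, smul_zero, zero_add, smul_eq_mul]
    have h2 : D m = D u := by
      rw [hm_def, map_sub, D.map_algebraMap, sub_zero]
    rw [h1, h2]
  have hvm : O.valuation (D m) < 1 := lt_of_le_of_lt (hD m) hc
  calc O.valuation (D f) = O.valuation q * O.valuation (D m) := by rw [hDf, map_mul]
    _ < O.valuation q * 1 := mul_lt_mul_of_pos_left hvm (lt_of_le_of_ne zero_le hvq.symm)
    _ = O.valuation f := by rw [mul_one, hfu, map_mul, hvu, one_mul]

/-- KERNEL LAW, `W`-form (gen 20, §31): such a place has `W(K,v) = 0`.  This is the I3 side of the cut: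
I3 has `p`-divisible value group `ℤ[1/p](1, √2, √3)` and residue field `k`. [folklore] -/
theorem not_wNonzero_of_frobeniusDivisible (O : ValuationSubring K) (p : ℕ) [CharP K p]
    (hres : ∀ z ∈ O, ∃ c : k, O.valuation (z - algebraMap k K c) < 1)
    (hdiv : ∀ f : K, f ≠ 0 → ∃ g : K, O.valuation f = O.valuation (g ^ p)) :
    ¬ WNonzero k O := by
  rintro ⟨D, hD, f, hf, hEq⟩
  exact (valuation_derivation_lt_of_frobeniusDivisible O p hres hdiv D hD hf).ne hEq

/-- `W = 0` HALF of the true residual (gen 20, §32; tag UNDECIDED · WEAKER than the root · located at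
`(e, c, n) = (3, 3, 4)` · inhabited by I3): `NonKHToricArchLU e c n` restricted to places with no contractive
`k`-derivation of non-zero graded character. -/
def NonKHToricArchLUWZero (e c n : ℕ) : Prop :=
  ∀ p : ℕ, p.Prime → ∀ (k K : Type) [Field k] [CharP k p] [Field K] [Algebra k K],
    Algebra.trdeg k K ≤ n → ∀ O : ValuationSubring K, Nonempty O.valuation.RankOne →
    (∀ y ∈ O, ∃ f : Polynomial k, f ≠ 0 ∧ Polynomial.aeval y f ∈ O.nonunits) →
    ¬ IsAbhyankarPlace O (algebraMap k K).fieldRange ⊤ →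
    ¬ (∃ d : ℕ, d < n ∧ SepDenseBelow k O d) → ¬ ToricDenseBelow k O e → ¬ KHTopBelow k O c →
    ¬ WNonzero k O → RelLocalUniformization k K O

/-- `W ≠ 0` HALF of the true residual (gen 20, §32; tag UNDECIDED · WEAKER than the root · located at
`(e, c, n) = (3, 3, 4)` · inhabited by I3_ℓ, `ℓ ≠ p`): `NonKHToricArchLU e c n` restricted to places carrying a
contractive `k`-derivation with a non-zero graded character. -/
def NonKHToricArchLUWPos (e c n : ℕ) : Prop :=
  ∀ p : ℕ, p.Prime → ∀ (k K : Type) [Field k] [CharP k p] [Field K] [Algebra k K],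
    Algebra.trdeg k K ≤ n → ∀ O : ValuationSubring K, Nonempty O.valuation.RankOne →
    (∀ y ∈ O, ∃ f : Polynomial k, f ≠ 0 ∧ Polynomial.aeval y f ∈ O.nonunits) →
    ¬ IsAbhyankarPlace O (algebraMap k K).fieldRange ⊤ →
    ¬ (∃ d : ℕ, d < n ∧ SepDenseBelow k O d) → ¬ ToricDenseBelow k O e → ¬ KHTopBelow k O c →
    WNonzero k O → RelLocalUniformization k K O

/-- `nonKHToricArchLUWZero_of_nonKHToric`: Auxiliary step of this node's calculus, VERBATIM from the lens file (see
the module docstring); the statement is its type. [folklore] -/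
theorem nonKHToricArchLUWZero_of_nonKHToric {e c n : ℕ} (h : NonKHToricArchLU e c n) :
    NonKHToricArchLUWZero e c n :=
  fun p hp k K _ _ _ _ hd O h1 h0 hA hnd hnt hnk _ => h p hp k K hd O h1 h0 hA hnd hnt hnk

/-- `nonKHToricArchLUWPos_of_nonKHToric`: Auxiliary step of this node's calculus, VERBATIM from the lens file (see
the module docstring); the statement is its type. [folklore] -/
theorem nonKHToricArchLUWPos_of_nonKHToric {e c n : ℕ} (h : NonKHToricArchLU e c n) :
    NonKHToricArchLUWPos e c n :=
  fun p hp k K _ _ _ _ hd O h1 h0 hA hnd hnt hnk _ => h p hp k K hd O h1 h0 hA hnd hnt hnk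

/-- THE W-CUT (gen 20, §32; kernel, exact): the true residual is the conjunction of its two `W`-halves. [folklore] -/
theorem nonKHToricArchLU_iff_wcut {e c n : ℕ} :
    NonKHToricArchLU e c n ↔ NonKHToricArchLUWZero e c n ∧ NonKHToricArchLUWPos e c n := by
  refine ⟨fun h => ⟨nonKHToricArchLUWZero_of_nonKHToric h, nonKHToricArchLUWPos_of_nonKHToric h⟩, ?_⟩
  rintro ⟨h₀, h₁⟩ p hp k K _ _ _ _ hd O hr hz hA hnd hnt hnk
  by_cases hW : WNonzero k O
  · exact h₁ p hp k K hd O hr hz hA hnd hnt hnk hW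
  · exact h₀ p hp k K hd O hr hz hA hnd hnt hnk hW

/-- `nonKHToricArchLUWZero_of_root`: Auxiliary step of this node's calculus, VERBATIM from the lens file (see the
module docstring); the statement is its type. [folklore] -/
theorem nonKHToricArchLUWZero_of_root (hS : _root_.ResolutionOfSingularities) (e c n : ℕ) :
    NonKHToricArchLUWZero e c n :=
  nonKHToricArchLUWZero_of_nonKHToric (nonKHToricArchLU_of_root hS e c n)

/-- `nonKHToricArchLUWPos_of_root`: Auxiliary step of this node's calculus, VERBATIM from the lens file (see the
module docstring); the statement is its type. [folklore] -/
theorem nonKHToricArchLUWPos_of_root (hS : _root_.ResolutionOfSingularities) (e c n : ℕ) :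
    NonKHToricArchLUWPos e c n :=
  nonKHToricArchLUWPos_of_nonKHToric (nonKHToricArchLU_of_root hS e c n)

/-- DECIDING THEOREM, W-cut form (gen 20, §32): `closes_sigma` with the true residual replaced by its two
`W`-halves.  Pieces: floor port · CJS port · Π₁ port · `W = 0` half (∋ I3) · `W ≠ 0` half (∋ I3_ℓ) ·
0642. [folklore] -/
theorem closes_wcut (hCP : CossartPiltant2019LU3.{0}) (hCJS : CossartJannsenSaito2020Embedded.{0})
    (hAsc : KK05NCVAscent)
    (hW₀ : ∀ d, 4 ≤ d → NonKHToricArchLUWZero 3 3 d) (hW₁ : ∀ d, 4 ≤ d → NonKHToricArchLUWPos 3 3 d)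
    (h₃ : Valuative.PatchingRel) : _root_.ResolutionOfSingularities :=
  closes_sigma hCP hCJS hAsc (fun d hd => nonKHToricArchLU_iff_wcut.2 ⟨hW₀ d hd, hW₁ d hd⟩) h₃

/-- Both `W`-halves follow from the root outright (they are WEAKER pieces). [folklore] -/
theorem wcut_of_root (hS : _root_.ResolutionOfSingularities) (d : ℕ) :
    NonKHToricArchLUWZero 3 3 d ∧ NonKHToricArchLUWPos 3 3 d :=
  nonKHToricArchLU_iff_wcut.1 (nonKHToricArchLU_of_root hS 3 3 d)

/-- Root-level summary, W-cut form (gen 20, §32): modulo floor + CJS + Π₁ + 0642 the ROOT is EQUIVALENT to the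
conjunction of the two `W`-halves of the residual family (`root_iff_nonKHToric_sigma` transported along the
exact cut). [folklore] -/
theorem root_iff_wcut_sigma (hCP : CossartPiltant2019LU3.{0})
    (hCJS : CossartJannsenSaito2020Embedded.{0}) (hAsc : KK05NCVAscent) (h₃ : Valuative.PatchingRel) :
    _root_.ResolutionOfSingularities ↔
      ∀ d, 4 ≤ d → NonKHToricArchLUWZero 3 3 d ∧ NonKHToricArchLUWPos 3 3 d := by
  rw [root_iff_nonKHToric_sigma hCP hCJS hAsc h₃]
  exact forall₂_congr fun d _ => nonKHToricArchLU_iff_wcut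

end WCut

end Summit.ResolutionOfSingularities.ResolutionOfSingularities.Theorems.WCut
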